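import Literature.MathematicalPhysics.QuantumLattice.InfVolFermionStateCorrelationPositiveDefinite
import Literature.MathematicalPhysics.QuantumLattice.HubbardWindowCertificateD4
import HarnessLib

/-!
# Ventures/CertifiedManyBodySolver — Transport/D4VecAction.lean

HONEST FRAMING: first certified bounds; not a superconductivity verdict; every number certified or
labelled float.  (Speedrun `mbsolver`, sr-mbsolver-lit-1 gen 10; G2 Stage 2 support; zero compute, no certificate,
no state class, no number of the tables, no definition, no named fact.)

**The linear action `d4Vec : D₄ → (ℤ² → ℤ²)` of the square-lattice point group** (`FockRelabel.lean`: `r i ↦ rot^i`,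
`sr i ↦ refl ∘ rot^i`, `rot (a,b) = (-b,a)`, `refl (a,b) = (a,-b)`) — the API consumed by the `D₄`-ORBIT-MEAN correlation
functions `C(v) = 8⁻¹ Σ_{g∈D₄} C₀(g·v)` of the stripe / Néel Bragg-weight ceilings (`Observables/StripeOrderKernelCeiling`,
`Observables/BraggWeightSymmetry`, `Certificates/HubbardSquare_n7o8_stripeStar_*`).  The tree had `d4Vec_injective`,
`d4Vec_eq_zero_iff`, `d4Vec_one`, `Transport.d4Vec_zero`, `SpinStarTL.d4Vec_neg`, `sum_steps_d4Vec` and the torus law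
`d4Site_mul_holds`; this file adds, on `ℤ²`: §0 enumeration of `D₄` (`sum_univ_dihedralFour`); §1 the eight maps in
coordinates; §2 additivity `d4Vec_add` (`d4Vec_sub`, `d4Vec_zsmul`); §3 the ACTION LAW `d4Vec_mul` (+ inverses); §4 orbit
sums — reindexing `sum_univ_d4Vec_d4Vec`, the orbits of `0`, `e₁`, `e₁+e₂` (general `2 •` forms and the real `2 *` forms
`d4_sum_zero/e1/e2/me1/me2/d1/d2/d3`, `unitVec_*_eq`, `e1pe2_eq`, `e2me1_eq`, `d4Emb_pt` — the names/statements of the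
inline `D4` block of typer g171's staged stripe-star batch, which this import replaces); §5 the three lattice symmetries
of `BraggWeightSymmetry` as group elements (`v ∘ swap = sr 3·v`, `update v 0 (-v 0) = sr 2·v`, `update v 1 (-v 1) = s·v`)
and the invariance of orbit sums / orbit means `(8:ℂ)⁻¹ * ∑ g, C₀ (d4Vec g v)` under them (`d4Mean_comp_swap` = `hswap`,
`d4Mean_update_zero_neg` = `hrefl0`, `d4Mean_update_one_neg` = `hrefl1`), `d4Mean_zero`, `d4Mean_e1`; §6
`IsPositiveDefinite C₀ ⇒ IsPositiveDefinite (v ↦ 8⁻¹ Σ_g C₀ (g·v))` (S2a's `sum` / `real_smul` / `comp_addMonoidHom`).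
References: Scalapino, Phys. Rep. 250 (1995) 329, §2; Mathlib `GroupTheory/SpecificGroups/Dihedral`.
-/

namespace Summit.Ventures.CertifiedManyBodySolver.Transport

open Literature.MathematicalPhysics.QuantumLattice Literature.Probability.LatticeModels
open Literature.Analysis.FunctionSpaces
open DihedralGroup
open scoped BigOperators

/-! ### §0. Enumerating `D₄` -/

/-- The eight elements of `D₄` (`r 0 = 1`). [folklore] -/
theorem dihedralFour_cases (g : DihedralGroup 4) :
    g = 1 ∨ g = r 1 ∨ g = r 2 ∨ g = r 3 ∨ g = sr 0 ∨ g = sr 1 ∨ g = sr 2 ∨ g = sr 3 := by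
  revert g; decide

/-- `Finset.univ` of `D₄`, listed. [folklore] -/
theorem univ_dihedralFour :
    (Finset.univ : Finset (DihedralGroup 4)) = {1, r 1, r 2, r 3, sr 0, sr 1, sr 2, sr 3} := by
  decide

/-- **Eight-term expansion of a sum over `D₄`.** [folklore] -/
theorem sum_univ_dihedralFour {M : Type*} [AddCommMonoid M] (f : DihedralGroup 4 → M) :
    ∑ g : DihedralGroup 4, f g =
      f 1 + f (r 1) + f (r 2) + f (r 3) + f (sr 0) + f (sr 1) + f (sr 2) + f (sr 3) := by
  rw [univ_dihedralFour, Finset.sum_insert (by decide), Finset.sum_insert (by decide),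
    Finset.sum_insert (by decide), Finset.sum_insert (by decide), Finset.sum_insert (by decide),
    Finset.sum_insert (by decide), Finset.sum_insert (by decide), Finset.sum_singleton]
  simp only [add_assoc]

/-! ### §1. The eight maps in coordinates (`d4Vec 1 v = v` is `d4Vec_one`, by `rfl`; `d4Vec γ 0 = 0` is
`Transport.d4Vec_zero`; `d4Vec γ (-v) = -d4Vec γ v` is `SpinStarTL.d4Vec_neg` or `map_neg (AddMonoidHom.mk' _ (d4Vec_add γ))`) -/

/-- `r · (a, b) = (-b, a)` (quarter turn). [cite: Scalapino1995, §2] -/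
theorem d4Vec_r_one_apply (v : Site 2) : d4Vec (r 1) v = ![-v 1, v 0] := rfl

/-- `r² · (a, b) = (-a, -b)`. [cite: Scalapino1995, §2] -/
theorem d4Vec_r_two_apply (v : Site 2) : d4Vec (r 2) v = ![-v 0, -v 1] := by
  ext k; fin_cases k <;> rfl

/-- `r³ · (a, b) = (b, -a)`. [cite: Scalapino1995, §2] -/
theorem d4Vec_r_three_apply (v : Site 2) : d4Vec (r 3) v = ![v 1, -v 0] :=
  (show d4Vec (r 3) v = (fun w : Site 2 => (![-w 1, w 0] : Site 2)) ((fun w : Site 2 => (![-w 1, w 0] : Site 2)) ((fun w : Site 2 => (![-w 1, w 0] : Site 2)) v)) from rfl).trans (by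
    ext k; fin_cases k <;> simp)

/-- `s · (a, b) = (a, -b)` (reflection in the `x`-axis). [cite: Scalapino1995, §2] -/
theorem d4Vec_sr_zero_apply (v : Site 2) : d4Vec (sr 0) v = ![v 0, -v 1] := rfl

/-- `s r · (a, b) = (-b, -a)` (anti-diagonal reflection). [cite: Scalapino1995, §2] -/
theorem d4Vec_sr_one_apply (v : Site 2) : d4Vec (sr 1) v = ![-v 1, -v 0] := by
  ext k; fin_cases k <;> rfl

/-- `s r² · (a, b) = (-a, b)` (reflection in the `y`-axis). [cite: Scalapino1995, §2] -/
theorem d4Vec_sr_two_apply (v : Site 2) : d4Vec (sr 2) v = ![-v 0, v 1] :=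
  (show d4Vec (sr 2) v = (fun w : Site 2 => (![w 0, -w 1] : Site 2)) ((fun w : Site 2 => (![-w 1, w 0] : Site 2)) ((fun w : Site 2 => (![-w 1, w 0] : Site 2)) v)) from rfl).trans (by
    ext k; fin_cases k <;> simp)

/-- `s r³ · (a, b) = (b, a)` (diagonal reflection = coordinate swap). [cite: Scalapino1995, §2] -/
theorem d4Vec_sr_three_apply (v : Site 2) : d4Vec (sr 3) v = ![v 1, v 0] :=
  (show d4Vec (sr 3) v =
      (fun w : Site 2 => (![w 0, -w 1] : Site 2)) ((fun w : Site 2 => (![-w 1, w 0] : Site 2)) ((fun w : Site 2 => (![-w 1, w 0] : Site 2)) ((fun w : Site 2 => (![-w 1, w 0] : Site 2)) v))) from rfl).trans (by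
    ext k; fin_cases k <;> simp)

/-! ### §2. Additivity -/

/-- **Each `d4Vec γ` is additive** (a linear map of `ℤ²`). [cite: Scalapino1995, §2] -/
theorem d4Vec_add (γ : DihedralGroup 4) (v w : Site 2) : d4Vec γ (v + w) = d4Vec γ v + d4Vec γ w := by
  rcases dihedralFour_cases γ with rfl | rfl | rfl | rfl | rfl | rfl | rfl | rfl
  · rfl
  all_goals
    ext k
    fin_cases k <;>
      simp [d4Vec_r_one_apply, d4Vec_r_two_apply, d4Vec_r_three_apply, d4Vec_sr_zero_apply,
        d4Vec_sr_one_apply, d4Vec_sr_two_apply, d4Vec_sr_three_apply] <;> ring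

/-- `γ · (v - w) = γ · v - γ · w`. [folklore] -/
theorem d4Vec_sub (γ : DihedralGroup 4) (v w : Site 2) : d4Vec γ (v - w) = d4Vec γ v - d4Vec γ w :=
  map_sub (AddMonoidHom.mk' (d4Vec γ) (d4Vec_add γ)) v w

/-- `γ · (n • v) = n • (γ · v)` for `n : ℤ`. [folklore] -/
theorem d4Vec_zsmul (γ : DihedralGroup 4) (n : ℤ) (v : Site 2) : d4Vec γ (n • v) = n • d4Vec γ v :=
  map_zsmul (AddMonoidHom.mk' (d4Vec γ) (d4Vec_add γ)) n v

/-- Coordinates: `v = v 0 • e₁ + v 1 • e₂`. [folklore] -/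
theorem site_two_eq_zsmul_add_zsmul (v : Site 2) : v = v 0 • (![1, 0] : Site 2) + v 1 • (![0, 1] : Site 2) := by
  ext k; fin_cases k <;> simp

/-- `γ · v = v 0 • (γ · e₁) + v 1 • (γ · e₂)`. [folklore] -/
theorem d4Vec_eq_zsmul_add_zsmul (γ : DihedralGroup 4) (v : Site 2) :
    d4Vec γ v = v 0 • d4Vec γ ![1, 0] + v 1 • d4Vec γ ![0, 1] := by
  conv_lhs => rw [site_two_eq_zsmul_add_zsmul v]
  rw [d4Vec_add, d4Vec_zsmul, d4Vec_zsmul]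

/-! ### §3. The action law -/

/-- The action law on the basis vectors (a finite check). [folklore] -/
theorem d4Vec_mul_basis : ∀ γ γ' : DihedralGroup 4,
    d4Vec (γ * γ') (![1, 0] : Site 2) = d4Vec γ (d4Vec γ' ![1, 0]) ∧
      d4Vec (γ * γ') (![0, 1] : Site 2) = d4Vec γ (d4Vec γ' ![0, 1]) := by
  decide

/-- **`d4Vec` is a left action of `D₄` on `ℤ²`**: `(γγ') · v = γ · (γ' · v)` (Mathlib's multiplication,
`sr i * r j = sr (i + j)`, `r i * sr j = sr (j - i)`; the torus twin is `d4Site_mul_holds`).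
[cite: Scalapino1995, §2] -/
theorem d4Vec_mul (γ γ' : DihedralGroup 4) (v : Site 2) : d4Vec (γ * γ') v = d4Vec γ (d4Vec γ' v) := by
  rw [d4Vec_eq_zsmul_add_zsmul (γ * γ') v, (d4Vec_mul_basis γ γ').1, (d4Vec_mul_basis γ γ').2,
    d4Vec_eq_zsmul_add_zsmul γ' v, d4Vec_add γ, d4Vec_zsmul, d4Vec_zsmul]

/-- `γ⁻¹ · (γ · v) = v`. [folklore] -/
theorem d4Vec_inv_apply (γ : DihedralGroup 4) (v : Site 2) : d4Vec γ⁻¹ (d4Vec γ v) = v := by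
  rw [← d4Vec_mul, inv_mul_cancel]; rfl

/-- `γ · (γ⁻¹ · v) = v`. [folklore] -/
theorem d4Vec_apply_inv (γ : DihedralGroup 4) (v : Site 2) : d4Vec γ (d4Vec γ⁻¹ v) = v := by
  rw [← d4Vec_mul, mul_inv_cancel]; rfl

/-! ### §4. Orbit sums -/

section OrbitSums

variable {M : Type*} [AddCommMonoid M]

/-- **Reindexing an orbit sum**: `Σ_g F(g·(γ·v)) = Σ_g F(g·v)` (right multiplication by `γ` permutes `D₄`).
[folklore] -/
theorem sum_univ_d4Vec_d4Vec (F : Site 2 → M) (γ : DihedralGroup 4) (v : Site 2) :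
    ∑ g : DihedralGroup 4, F (d4Vec g (d4Vec γ v)) = ∑ g : DihedralGroup 4, F (d4Vec g v) := by
  simp_rw [← d4Vec_mul]
  exact Fintype.sum_equiv (Equiv.mulRight γ) _ _ fun g => rfl

/-- The orbit sum at the origin: `Σ_g F(g·0) = 8 • F 0`. [folklore] -/
theorem sum_univ_d4Vec_zero (F : Site 2 → M) :
    ∑ g : DihedralGroup 4, F (d4Vec g 0) = 8 • F 0 := by
  simp_rw [show ∀ g : DihedralGroup 4, d4Vec g (0 : Site 2) = 0 from fun g => (d4Vec_eq_zero_iff g 0).2 rfl]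
  rw [Finset.sum_const, Finset.card_univ, DihedralGroup.card]

/-- **The orbit of `e₁ = (1, 0)`**: the eight images `g · e₁` run through `e₁, e₂, -e₁, -e₂` twice each, so
`Σ_g F(g·e₁) = 2 • (F e₁ + F (-e₁) + F e₂ + F (-e₂))`. [cite: Scalapino1995, §2] -/
theorem sum_univ_d4Vec_e1 (F : Site 2 → M) :
    ∑ g : DihedralGroup 4, F (d4Vec g ![1, 0]) = 2 • (F ![1, 0] + F ![-1, 0] + F ![0, 1] + F ![0, -1]) := by
  rw [sum_univ_dihedralFour]
  rw [show d4Vec 1 (![1, 0] : Site 2) = ![1, 0] from by decide,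
    show d4Vec (r 1) (![1, 0] : Site 2) = ![0, 1] from by decide,
    show d4Vec (r 2) (![1, 0] : Site 2) = ![-1, 0] from by decide,
    show d4Vec (r 3) (![1, 0] : Site 2) = ![0, -1] from by decide,
    show d4Vec (sr 0) (![1, 0] : Site 2) = ![1, 0] from by decide,
    show d4Vec (sr 1) (![1, 0] : Site 2) = ![0, -1] from by decide,
    show d4Vec (sr 2) (![1, 0] : Site 2) = ![-1, 0] from by decide,
    show d4Vec (sr 3) (![1, 0] : Site 2) = ![0, 1] from by decide, two_nsmul]
  abel

/-- `-e₁`, `e₂`, `-e₂` lie in the orbit of `e₁`: the orbit sums there coincide with the one at `e₁`.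
[folklore] -/
theorem sum_univ_d4Vec_negE1 (F : Site 2 → M) :
    ∑ g : DihedralGroup 4, F (d4Vec g ![-1, 0]) = ∑ g : DihedralGroup 4, F (d4Vec g ![1, 0]) := by
  rw [show (![-1, 0] : Site 2) = d4Vec (r 2) ![1, 0] from by decide, sum_univ_d4Vec_d4Vec]

/-- See `sum_univ_d4Vec_negE1`. [folklore] -/
theorem sum_univ_d4Vec_e2 (F : Site 2 → M) :
    ∑ g : DihedralGroup 4, F (d4Vec g ![0, 1]) = ∑ g : DihedralGroup 4, F (d4Vec g ![1, 0]) := by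
  rw [show (![0, 1] : Site 2) = d4Vec (r 1) ![1, 0] from by decide, sum_univ_d4Vec_d4Vec]

/-- See `sum_univ_d4Vec_negE1`. [folklore] -/
theorem sum_univ_d4Vec_negE2 (F : Site 2 → M) :
    ∑ g : DihedralGroup 4, F (d4Vec g ![0, -1]) = ∑ g : DihedralGroup 4, F (d4Vec g ![1, 0]) := by
  rw [show (![0, -1] : Site 2) = d4Vec (r 3) ![1, 0] from by decide, sum_univ_d4Vec_d4Vec]

/-- **The orbit of the diagonal step `e₁ + e₂ = (1, 1)`**: the images run through `±(1,1), ±(1,-1)` twice each.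
[cite: Scalapino1995, §2] -/
theorem sum_univ_d4Vec_d1 (F : Site 2 → M) :
    ∑ g : DihedralGroup 4, F (d4Vec g ![1, 1]) = 2 • (F ![1, 1] + F ![-1, -1] + F ![-1, 1] + F ![1, -1]) := by
  rw [sum_univ_dihedralFour]
  rw [show d4Vec 1 (![1, 1] : Site 2) = ![1, 1] from by decide,
    show d4Vec (r 1) (![1, 1] : Site 2) = ![-1, 1] from by decide,
    show d4Vec (r 2) (![1, 1] : Site 2) = ![-1, -1] from by decide,
    show d4Vec (r 3) (![1, 1] : Site 2) = ![1, -1] from by decide,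
    show d4Vec (sr 0) (![1, 1] : Site 2) = ![1, -1] from by decide,
    show d4Vec (sr 1) (![1, 1] : Site 2) = ![-1, -1] from by decide,
    show d4Vec (sr 2) (![1, 1] : Site 2) = ![-1, 1] from by decide,
    show d4Vec (sr 3) (![1, 1] : Site 2) = ![1, 1] from by decide, two_nsmul]
  abel

/-- `(1,-1)` lies in the orbit of `(1,1)`. [folklore] -/
theorem sum_univ_d4Vec_d2 (F : Site 2 → M) :
    ∑ g : DihedralGroup 4, F (d4Vec g ![1, -1]) = ∑ g : DihedralGroup 4, F (d4Vec g ![1, 1]) := by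
  rw [show (![1, -1] : Site 2) = d4Vec (r 3) ![1, 1] from by decide, sum_univ_d4Vec_d4Vec]

/-- `(-1,1)` lies in the orbit of `(1,1)`. [folklore] -/
theorem sum_univ_d4Vec_d3 (F : Site 2 → M) :
    ∑ g : DihedralGroup 4, F (d4Vec g ![-1, 1]) = ∑ g : DihedralGroup 4, F (d4Vec g ![1, 1]) := by
  rw [show (![-1, 1] : Site 2) = d4Vec (r 1) ![1, 1] from by decide, sum_univ_d4Vec_d4Vec]

/-- `(-1,-1)` lies in the orbit of `(1,1)`. [folklore] -/
theorem sum_univ_d4Vec_negd1 (F : Site 2 → M) :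
    ∑ g : DihedralGroup 4, F (d4Vec g ![-1, -1]) = ∑ g : DihedralGroup 4, F (d4Vec g ![1, 1]) := by
  rw [show (![-1, -1] : Site 2) = d4Vec (r 2) ![1, 1] from by decide, sum_univ_d4Vec_d4Vec]

end OrbitSums

section RealOrbitSums

/-- `Σ_g F(g·(0,0)) = 8 F(0,0)`. [folklore] -/
theorem d4_sum_zero (F : Site 2 → ℝ) : ∑ g : DihedralGroup 4, F (d4Vec g ![0, 0]) = 8 * F ![0, 0] := by
  rw [show (![0, 0] : Site 2) = 0 from by decide, sum_univ_d4Vec_zero, nsmul_eq_mul]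
  norm_num

/-- `Σ_g F(g·e₁)` over the reals. [cite: Scalapino1995, §2] -/
theorem d4_sum_e1 (F : Site 2 → ℝ) : ∑ g : DihedralGroup 4, F (d4Vec g ![1, 0]) =
    2 * (F ![1, 0] + F ![-1, 0] + F ![0, 1] + F ![0, -1]) := by
  rw [sum_univ_d4Vec_e1, nsmul_eq_mul]; norm_num

/-- `Σ_g F(g·e₂)` over the reals. [folklore] -/
theorem d4_sum_e2 (F : Site 2 → ℝ) : ∑ g : DihedralGroup 4, F (d4Vec g ![0, 1]) =
    2 * (F ![1, 0] + F ![-1, 0] + F ![0, 1] + F ![0, -1]) := by rw [sum_univ_d4Vec_e2, d4_sum_e1]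

/-- `Σ_g F(g·(-e₁))` over the reals. [folklore] -/
theorem d4_sum_me1 (F : Site 2 → ℝ) : ∑ g : DihedralGroup 4, F (d4Vec g ![-1, 0]) =
    2 * (F ![1, 0] + F ![-1, 0] + F ![0, 1] + F ![0, -1]) := by rw [sum_univ_d4Vec_negE1, d4_sum_e1]

/-- `Σ_g F(g·(-e₂))` over the reals. [folklore] -/
theorem d4_sum_me2 (F : Site 2 → ℝ) : ∑ g : DihedralGroup 4, F (d4Vec g ![0, -1]) =
    2 * (F ![1, 0] + F ![-1, 0] + F ![0, 1] + F ![0, -1]) := by rw [sum_univ_d4Vec_negE2, d4_sum_e1]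

/-- `Σ_g F(g·(1,1))` over the reals. [cite: Scalapino1995, §2] -/
theorem d4_sum_d1 (F : Site 2 → ℝ) : ∑ g : DihedralGroup 4, F (d4Vec g ![1, 1]) =
    2 * (F ![1, 1] + F ![-1, -1] + F ![-1, 1] + F ![1, -1]) := by
  rw [sum_univ_d4Vec_d1, nsmul_eq_mul]; norm_num

/-- `Σ_g F(g·(1,-1))` over the reals. [folklore] -/
theorem d4_sum_d2 (F : Site 2 → ℝ) : ∑ g : DihedralGroup 4, F (d4Vec g ![1, -1]) =
    2 * (F ![1, 1] + F ![-1, -1] + F ![-1, 1] + F ![1, -1]) := by rw [sum_univ_d4Vec_d2, d4_sum_d1]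

/-- `Σ_g F(g·(-1,1))` over the reals. [folklore] -/
theorem d4_sum_d3 (F : Site 2 → ℝ) : ∑ g : DihedralGroup 4, F (d4Vec g ![-1, 1]) =
    2 * (F ![1, 1] + F ![-1, -1] + F ![-1, 1] + F ![1, -1]) := by rw [sum_univ_d4Vec_d3, d4_sum_d1]

/-- `e₁ = (1, 0)` in matrix notation. [folklore] -/
theorem unitVec_zero_eq : (unitVec 0 : Site 2) = ![1, 0] := by decide

/-- `e₂ = (0, 1)` in matrix notation. [folklore] -/
theorem unitVec_one_eq : (unitVec 1 : Site 2) = ![0, 1] := by decide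

/-- `e₁ + e₂ = (1, 1)`. [folklore] -/
theorem e1pe2_eq : (unitVec 0 + unitVec 1 : Site 2) = ![1, 1] := by decide

/-- `e₂ - e₁ = (-1, 1)`. [folklore] -/
theorem e2me1_eq : (unitVec 1 - unitVec 0 : Site 2) = ![-1, 1] := by decide

/-- The affine `D₄` map of a region on an explicit site: `d4Emb γ w Λ (pt x) = pt (γ·x + w)`. [folklore] -/
@[simp] theorem d4Emb_pt (γ : DihedralGroup 4) (w : Site 2) {Λ : Finset (Site 2)} (x : Site 2) (hx : x ∈ Λ) :
    PolySite.d4Emb γ w Λ (PolySite.pt x hx) = PolySite.pt (d4Vec γ x + w) (d4Vec_add_mem_d4ShiftSet γ w hx) := rfl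

end RealOrbitSums

/-! ### §5. The lattice symmetries of `BraggWeightSymmetry.lean` as group elements -/

/-- Coordinate swap is `s r³`: `v ∘ swap = s r³ · v`. [cite: Scalapino1995, §2] -/
theorem comp_swap_eq_d4Vec (v : Site 2) : (v ∘ ⇑(Equiv.swap (0 : Fin 2) 1)) = d4Vec (sr 3) v := by
  rw [d4Vec_sr_three_apply]
  ext k; fin_cases k
  · simp [Equiv.swap_apply_left]
  · simp [Equiv.swap_apply_right]

/-- Reflection of the first coordinate is `s r²`: `update v 0 (-v 0) = s r² · v`. [cite: Scalapino1995, §2] -/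
theorem update_zero_neg_eq_d4Vec (v : Site 2) : Function.update v 0 (-v 0) = d4Vec (sr 2) v := by
  rw [d4Vec_sr_two_apply]
  ext k; fin_cases k <;> simp

/-- Reflection of the second coordinate is `s`: `update v 1 (-v 1) = s · v`. [cite: Scalapino1995, §2] -/
theorem update_one_neg_eq_d4Vec (v : Site 2) : Function.update v 1 (-v 1) = d4Vec (sr 0) v := by
  rw [d4Vec_sr_zero_apply]
  ext k; fin_cases k <;> simp

section Invariance

variable {M : Type*} [AddCommMonoid M] (F : Site 2 → M)

/-- Orbit sums are swap-invariant. [folklore] -/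
theorem d4Sum_comp_swap (v : Site 2) :
    ∑ g : DihedralGroup 4, F (d4Vec g (v ∘ ⇑(Equiv.swap (0 : Fin 2) 1))) = ∑ g : DihedralGroup 4, F (d4Vec g v) := by rw [comp_swap_eq_d4Vec, sum_univ_d4Vec_d4Vec]

/-- Orbit sums are invariant under `x ↦ -x`. [folklore] -/
theorem d4Sum_update_zero_neg (v : Site 2) :
    ∑ g : DihedralGroup 4, F (d4Vec g (Function.update v 0 (-v 0))) = ∑ g : DihedralGroup 4, F (d4Vec g v) := by rw [update_zero_neg_eq_d4Vec, sum_univ_d4Vec_d4Vec]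

/-- Orbit sums are invariant under `y ↦ -y`. [folklore] -/
theorem d4Sum_update_one_neg (v : Site 2) :
    ∑ g : DihedralGroup 4, F (d4Vec g (Function.update v 1 (-v 1))) = ∑ g : DihedralGroup 4, F (d4Vec g v) := by rw [update_one_neg_eq_d4Vec, sum_univ_d4Vec_d4Vec]

end Invariance

section Mean

variable (C₀ : Site 2 → ℂ)

/-- `hswap` of `BraggWeightSymmetry.lean` for an orbit mean. [folklore] -/
theorem d4Mean_comp_swap : ∀ v : Fin 2 → ℤ,
    (8 : ℂ)⁻¹ * ∑ g : DihedralGroup 4, C₀ (d4Vec g (v ∘ Equiv.swap 0 1)) =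
      (8 : ℂ)⁻¹ * ∑ g : DihedralGroup 4, C₀ (d4Vec g v) := fun v => by rw [d4Sum_comp_swap]

/-- `hrefl0` of `BraggWeightSymmetry.lean` for an orbit mean. [folklore] -/
theorem d4Mean_update_zero_neg : ∀ v : Fin 2 → ℤ,
    (8 : ℂ)⁻¹ * ∑ g : DihedralGroup 4, C₀ (d4Vec g (Function.update v 0 (-v 0))) =
      (8 : ℂ)⁻¹ * ∑ g : DihedralGroup 4, C₀ (d4Vec g v) := fun v => by rw [d4Sum_update_zero_neg]

/-- `hrefl1` of `BraggWeightSymmetry.lean` for an orbit mean. [folklore] -/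
theorem d4Mean_update_one_neg : ∀ v : Fin 2 → ℤ,
    (8 : ℂ)⁻¹ * ∑ g : DihedralGroup 4, C₀ (d4Vec g (Function.update v 1 (-v 1))) =
      (8 : ℂ)⁻¹ * ∑ g : DihedralGroup 4, C₀ (d4Vec g v) := fun v => by rw [d4Sum_update_one_neg]

/-- The orbit mean is `D₄`-invariant. [folklore] -/
theorem d4Mean_d4Vec (γ : DihedralGroup 4) (v : Site 2) : (8 : ℂ)⁻¹ * ∑ g : DihedralGroup 4, C₀ (d4Vec g (d4Vec γ v)) =
    (8 : ℂ)⁻¹ * ∑ g : DihedralGroup 4, C₀ (d4Vec g v) := by rw [sum_univ_d4Vec_d4Vec]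

/-- **The orbit mean at the origin is the plain value**: `C(0) = C₀(0)`. [folklore] -/
theorem d4Mean_zero : (8 : ℂ)⁻¹ * ∑ g : DihedralGroup 4, C₀ (d4Vec g 0) = C₀ 0 := by
  rw [sum_univ_d4Vec_zero, nsmul_eq_mul]
  push_cast
  ring

/-- **The orbit mean at `e₁`** is the four-arm average `(C₀ e₁ + C₀ (-e₁) + C₀ e₂ + C₀ (-e₂))/4`.
[cite: Scalapino1995, §2] -/
theorem d4Mean_e1 : (8 : ℂ)⁻¹ * ∑ g : DihedralGroup 4, C₀ (d4Vec g ![1, 0]) =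
    (4 : ℂ)⁻¹ * (C₀ ![1, 0] + C₀ ![-1, 0] + C₀ ![0, 1] + C₀ ![0, -1]) := by
  rw [sum_univ_d4Vec_e1, nsmul_eq_mul]
  push_cast
  ring

/-- The orbit mean takes the same value at `-e₁`, `e₂`, `-e₂` as at `e₁` (one value feeds `h1`–`h4` of the
charge star / arm ceilings). [folklore] -/
theorem d4Mean_negE1 : (8 : ℂ)⁻¹ * ∑ g : DihedralGroup 4, C₀ (d4Vec g ![-1, 0]) =
    (8 : ℂ)⁻¹ * ∑ g : DihedralGroup 4, C₀ (d4Vec g ![1, 0]) := by rw [sum_univ_d4Vec_negE1]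

/-- See `d4Mean_negE1`. [folklore] -/
theorem d4Mean_e2 : (8 : ℂ)⁻¹ * ∑ g : DihedralGroup 4, C₀ (d4Vec g ![0, 1]) =
    (8 : ℂ)⁻¹ * ∑ g : DihedralGroup 4, C₀ (d4Vec g ![1, 0]) := by rw [sum_univ_d4Vec_e2]

/-- See `d4Mean_negE1`. [folklore] -/
theorem d4Mean_negE2 : (8 : ℂ)⁻¹ * ∑ g : DihedralGroup 4, C₀ (d4Vec g ![0, -1]) =
    (8 : ℂ)⁻¹ * ∑ g : DihedralGroup 4, C₀ (d4Vec g ![1, 0]) := by rw [sum_univ_d4Vec_negE2]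

end Mean

/-! ### §6. Positive-definiteness of orbit means -/

/-- `C₀` positive definite ⇒ `v ↦ C₀ (γ · v)` positive definite (`d4Vec γ` is additive).
[cite: BergChristensenRessel1984, §4.1.6] -/
theorem isPositiveDefinite_comp_d4Vec {C₀ : Site 2 → ℂ} (hC : IsPositiveDefinite C₀) (γ : DihedralGroup 4) :
    IsPositiveDefinite (fun v => C₀ (d4Vec γ v)) :=
  hC.comp_addMonoidHom (AddMonoidHom.mk' (d4Vec γ) (d4Vec_add γ))

/-- `C₀` positive definite ⇒ the orbit SUM `v ↦ Σ_g C₀ (g · v)` is positive definite.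
[cite: BergChristensenRessel1984, §4.1.6] -/
theorem isPositiveDefinite_d4Sum {C₀ : Site 2 → ℂ} (hC : IsPositiveDefinite C₀) :
    IsPositiveDefinite (fun v => ∑ g : DihedralGroup 4, C₀ (d4Vec g v)) :=
  IsPositiveDefinite.sum Finset.univ fun g _ => isPositiveDefinite_comp_d4Vec hC g

/-- **`C₀` positive definite ⇒ the orbit MEAN `v ↦ 8⁻¹ Σ_g C₀ (g · v)` is positive definite** — the `hC` that
Herglotz / `IsPositiveDefinite.exists_measure_integral_exp_eq` needs for the orbit-mean correlation functions.
[cite: BergChristensenRessel1984, §4.1.6] -/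
theorem isPositiveDefinite_d4Mean {C₀ : Site 2 → ℂ} (hC : IsPositiveDefinite C₀) :
    IsPositiveDefinite (fun v => (8 : ℂ)⁻¹ * ∑ g : DihedralGroup 4, C₀ (d4Vec g v)) := by
  have h := (isPositiveDefinite_d4Sum hC).real_smul (r := 8⁻¹) (by norm_num)
  have e : (fun v => (8 : ℂ)⁻¹ * ∑ g : DihedralGroup 4, C₀ (d4Vec g v)) =
      (fun v => ((8⁻¹ : ℝ) : ℂ) * ∑ g : DihedralGroup 4, C₀ (d4Vec g v)) := by
    funext v
    simp only [Complex.ofReal_inv, Complex.ofReal_ofNat]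
  rw [e]
  exact h

end Summit.Ventures.CertifiedManyBodySolver.Transport
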